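import Summits.QuantumFields.YangMills.Theorems.FluctuationComparisonRegPrIntLS2BetaBodyRebaseResidual
import Summits.QuantumFields.YangMills.Theorems.FluctuationComparisonRegPrIntLS2BetaBodyRebaseTriple
import Summits.QuantumFields.YangMills.Theorems.FluctuationComparisonRegPrIntLS2BetaThm2GaugeSplitResidual
import HarnessLib

/-!
# S2β · GAP♯∘ — (RES-u.3) «THE COMPOSED DOOR TO THE THM-2-MOVED TRIPLE»: for ANY fine gauge transformation `u`, the stratum gap body at `(V, U₀, U)` ⟺ the body at
# `((u↓)⁻¹•V, ǔ⁻¹•U₀, u⁻¹•U)`, `ǔ := liftTransfTo (u↓)` — and the moved pair's relative chord is `E·E′` with `u⁻¹•U = E·U₀` (Thm 2's representative) and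
# `E′ := U₀·(ǔ⁻¹•U₀)⁻¹` (the background against its own block-constant re-gauging — (RES-u.4)'s object, (RES-u.5)'s `X`)

Cell `ym3-torus` (rung R3 = continuum `SU(2)` YM₃ on T³ at fixed lattice data — NOT d = 4, NOT infinite volume, NOT a mass gap, NOT Clay).  Width seat
`ym3-torus-px16` (gen 24); crux `stmt-QuantumFields-20520`, LINE g18-1 S2β (registry untouched); organ GAP♯∘; (RES-u) of record (architect px17 g23 2026-09-01T01:09Z,
desk №704).  The three doors are on the tree: ✓p839557 REBASE-U `body_gaugeAct_residual_iff` (residual re-gauging of the fine field, `V, U₀` fixed), ✓p839644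
`body_triple_iff` (simultaneous move `(u•V, û•U₀, û•U)`), ✓p839687 `residual_liftDesc_inv_mul` (`u = ǔ·r`, `r` residual).  THIS FILE composes them (px13 g29 (RES-u.5)
01:38Z: «the identification of the rows' `X 0` with `mlog(e^{ηA}·E)` after the triple move is px16's»):
* §1 ★★`body_iff_body_thm2Moved (hε₀) (u) : BODY((u↓)⁻¹•V, ǔ⁻¹•U₀, u⁻¹•U) ↔ BODY(V, U₀, U)` — `u⁻¹•U = r⁻¹•(ǔ⁻¹•U)` (✓`gaugeAct_mul_eq`), `r⁻¹` residual ⇒ REBASE-U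
  at the moved `(V′, U₀′)`, then the triple door with the coarse `(u↓)⁻¹` (its lift is `ǔ⁻¹` pointwise); USE form `body_of_body_thm2Moved`;
* §2 admissibility of the moved triple: `thm2Moved_mem_fibre` (`u⁻¹•U ∈ fibre((u↓)⁻¹•V)`), `thm2Moved_mem_argmin` (`ǔ⁻¹•U₀ ∈ argminHist((u↓)⁻¹•V)`,
  ✓`mem_argmin_gaugeAct_liftTransfTo`); `histGood` ∕ the datum guard by ✓`gaugeAct_mem_histGood_iff` ∕ ✓`plaqSmall_gaugeAct_iff'` (by name);
* §3 ★`relChord_thm2Moved (hrep : u⁻¹•U = E·U₀) : (u⁻¹•U) b·((ǔ⁻¹•U₀) b)⁻¹ = E b·(U₀ b·((ǔ⁻¹•U₀) b)⁻¹)` — the moved pair's relative chord IS `W·X` of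
  (RES-u.5)'s `wordOsc_mlog_mul` with `W = E` (`= e^{iηA}`, (R-3)) and `X = E′` ((RES-u.4)'s `U₀ b·((c•U₀) b)⁻¹` at `c = ǔ⁻¹`).
`--kind proof --supports stmt-QuantumFields-20520 --as helper`, count-neutral, DEFINITION-FREE (0 `def`, 0 `instance`, 0 `sorry`; default heartbeats).

HONEST.  Composition of landed doors + one line of group algebra; `hrep`'s torus reading of `Concl2Setup` is px13's (R-3) FILE 2; the B7 dictionary
`descendTo (E·U₀) = w•(e^{iB}·V)`, (RES-u.4)'s sizes, (REG-UP), (L2-TOWER), hsupp, hD, hDBX are OPEN ∕ HYPOTHESES elsewhere; nothing of Bałaban's analysis asserted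
([Balaban1985Variational] p.278, Thm 1 (8)–(10) p.279; [Balaban1985Averaging] (8), (11)–(13) pp.18–19; [Balaban1985RegularSpaces] Thm 2 p.83); GAP♯∘
(`stub_uniformFibreGapOrbit`, 0∕5), the five REGISTERED stubs, S2β, crux 20520, 19936, 19200, `YM3TorusSU2` NOT proved; rung R3 = SU(2) YM₃ on T³ — NOT d = 4, NOT
infinite volume, NOT a mass gap, NOT Clay; the Yang–Mills mass gap is NOT proved.
-/

set_option autoImplicit false

noncomputable section

namespace Summit.QuantumFields.YangMills.Theorems.FluctuationComparisonRegPrIntLS2BetaBodyDoorThm2Moved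

open Finset
open Literature.MathematicalPhysics.QuantumFieldTheory.Balaban1983to89
open T4Continuum T3ContinuumYM3Torus T3UnitScaleTilt T3TiltDescent T3LevelShift
open T3UnitLawDensityEML (ℰp)
open T3ConstrainedMinimiser (fibre)
open T3PrintedRegularMinimiser (minActionRegPr)
open T3PrintedRegularOrbits (liftTransfTo descTransf descTransf_liftTransfTo descendTo_gaugeAct)
open T3SectALandauChart (descTransf_inv)
open Summit.QuantumFields.YangMills.Theorems.FluctuationComparisonRegPrIntLS2BetaResidualGauge
  (gaugeAct_mul_eq residual_inv gaugeAct_mem_histGood_iff)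
open Summit.QuantumFields.YangMills.Theorems.FluctuationComparisonRegPrIntLS2BetaDatumGaugeWLOG (mem_argmin_gaugeAct_liftTransfTo)
open Summit.QuantumFields.YangMills.Theorems.FluctuationComparisonRegPrIntLS2BetaBodyRebaseResidual (body_gaugeAct_residual_iff)
open Summit.QuantumFields.YangMills.Theorems.FluctuationComparisonRegPrIntLS2BetaBodyRebaseTriple (body_triple_iff)
open Summit.QuantumFields.YangMills.Theorems.FluctuationComparisonRegPrIntLS2BetaThm2GaugeSplitResidual (residual_liftDesc_inv_mul)

variable (F : T3Family) {J K : ℕ} (hJK : J ≤ K)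

/-! ## §1 The composed door -/

/-- `u⁻¹•U = r⁻¹•(ǔ⁻¹•U)` with `ǔ := liftTransfTo (u↓)`, `r := ǔ⁻¹·u` — pointwise `((ǔ x)⁻¹·u x)⁻¹·(ǔ x)⁻¹ = (u x)⁻¹`. [cite: Balaban1985Averaging, (8) p.19] -/
theorem gaugeAct_inv_eq_residual_liftDesc (u : Site (F.P K) 0 → Matrix.specialUnitaryGroup (Fin 2) ℂ)
    (U : GaugeField (F.P K) 0 (Matrix.specialUnitaryGroup (Fin 2) ℂ)) :
    GaugeField.gaugeAct (fun x => (u x)⁻¹) U =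
      GaugeField.gaugeAct (fun x => ((liftTransfTo F J K hJK (descTransf F J K hJK u) x)⁻¹ * u x)⁻¹)
        (GaugeField.gaugeAct (fun x => (liftTransfTo F J K hJK (descTransf F J K hJK u) x)⁻¹) U) := by
  rw [← gaugeAct_mul_eq]
  congr 1
  funext x
  simp only [Pi.mul_apply, mul_inv_rev, inv_inv, mul_inv_cancel_right]

/-- The lift of the pointwise inverse of a coarse transformation is the pointwise inverse of the lift. [cite: Balaban1985Averaging, (12) p.19] -/
theorem liftTransfTo_inv_fun (w : Site (F.P J) 0 → Matrix.specialUnitaryGroup (Fin 2) ℂ) :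
    liftTransfTo F J K hJK (fun x => (w x)⁻¹) = fun z => (liftTransfTo F J K hJK w z)⁻¹ := by
  funext z
  rfl

/-- ★★ **THE COMPOSED DOOR**: for ANY fine gauge transformation `u` and `ε₀ ≥ 0`, the GAP♯∘ body (✓p838507's conclusion tail VERBATIM) at the Thm-2-moved triple
`((u↓)⁻¹•V, ǔ⁻¹•U₀, u⁻¹•U)` ⟺ at `(V, U₀, U)`. [cite: Balaban1985Variational, p.278, Thm 1 (8)-(10) p.279; Balaban1985RegularSpaces, Thm 2 p.83] -/
theorem body_iff_body_thm2Moved {ε₀ : ℝ} (hε₀ : 0 ≤ ε₀) (u : Site (F.P K) 0 → Matrix.specialUnitaryGroup (Fin 2) ℂ) (μ : ℝ)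
    (V : GaugeField (F.P J) 0 (Matrix.specialUnitaryGroup (Fin 2) ℂ)) (U₀ U : GaugeField (F.P K) 0 (Matrix.specialUnitaryGroup (Fin 2) ℂ)) :
    (μ * ((F.L : ℝ)⁻¹) ^ (2 * (K - J)) *
          (⨅ w : {w : GaugeTransf (F.P K) 0 (Matrix.specialUnitaryGroup (Fin 2) ℂ) | ∀ U : GaugeField (F.P K) 0 (Matrix.specialUnitaryGroup (Fin 2) ℂ),
              descendTo F ℰp J K hJK (GaugeField.gaugeAct w U) = descendTo F ℰp J K hJK U}, ∑ ℓ : PBond (F.P K) 0,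
            dist1 ((GaugeField.gaugeAct (fun x => (u x)⁻¹) U) ℓ *
              ((GaugeField.gaugeAct (w : GaugeTransf (F.P K) 0 (Matrix.specialUnitaryGroup (Fin 2) ℂ)) (GaugeField.gaugeAct (fun x => (liftTransfTo F J K hJK (descTransf F J K hJK u) x)⁻¹) U₀)) ℓ)⁻¹) ^ 2)
        ≤ wilsonAction4 (GaugeField.gaugeAct (fun x => (u x)⁻¹) U) -
          minActionRegPr F J K hJK ε₀ (GaugeField.gaugeAct (fun x => (descTransf F J K hJK u x)⁻¹) V)) ↔
      (μ * ((F.L : ℝ)⁻¹) ^ (2 * (K - J)) *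
          (⨅ w : {w : GaugeTransf (F.P K) 0 (Matrix.specialUnitaryGroup (Fin 2) ℂ) | ∀ U : GaugeField (F.P K) 0 (Matrix.specialUnitaryGroup (Fin 2) ℂ),
              descendTo F ℰp J K hJK (GaugeField.gaugeAct w U) = descendTo F ℰp J K hJK U}, ∑ ℓ : PBond (F.P K) 0,
            dist1 (U ℓ *
              ((GaugeField.gaugeAct (w : GaugeTransf (F.P K) 0 (Matrix.specialUnitaryGroup (Fin 2) ℂ)) U₀) ℓ)⁻¹) ^ 2)
        ≤ wilsonAction4 U -
          minActionRegPr F J K hJK ε₀ V) := by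
  have hr := residual_inv F hJK (residual_liftDesc_inv_mul F hJK u)
  have step1 := body_gaugeAct_residual_iff F hJK hr μ ε₀ (GaugeField.gaugeAct (fun x => (descTransf F J K hJK u x)⁻¹) V)
    (GaugeField.gaugeAct (fun x => (liftTransfTo F J K hJK (descTransf F J K hJK u) x)⁻¹) U₀) (GaugeField.gaugeAct (fun x => (liftTransfTo F J K hJK (descTransf F J K hJK u) x)⁻¹) U)
  have step2 := body_triple_iff F hJK hε₀ (fun x => (descTransf F J K hJK u x)⁻¹) μ V U₀ U
  rw [liftTransfTo_inv_fun] at step2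
  rw [gaugeAct_inv_eq_residual_liftDesc F hJK u U]
  exact step1.trans step2

/-- USE FORM: the body at `(V, U₀, U)` from the body at the Thm-2-moved triple. [cite: Balaban1985Variational, Thm 1 (8)-(10) p.279] -/
theorem body_of_body_thm2Moved {ε₀ : ℝ} (hε₀ : 0 ≤ ε₀) (u : Site (F.P K) 0 → Matrix.specialUnitaryGroup (Fin 2) ℂ) {μ : ℝ}
    {V : GaugeField (F.P J) 0 (Matrix.specialUnitaryGroup (Fin 2) ℂ)} {U₀ U : GaugeField (F.P K) 0 (Matrix.specialUnitaryGroup (Fin 2) ℂ)}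
    (h : (μ * ((F.L : ℝ)⁻¹) ^ (2 * (K - J)) *
          (⨅ w : {w : GaugeTransf (F.P K) 0 (Matrix.specialUnitaryGroup (Fin 2) ℂ) | ∀ U : GaugeField (F.P K) 0 (Matrix.specialUnitaryGroup (Fin 2) ℂ),
              descendTo F ℰp J K hJK (GaugeField.gaugeAct w U) = descendTo F ℰp J K hJK U}, ∑ ℓ : PBond (F.P K) 0,
            dist1 ((GaugeField.gaugeAct (fun x => (u x)⁻¹) U) ℓ *
              ((GaugeField.gaugeAct (w : GaugeTransf (F.P K) 0 (Matrix.specialUnitaryGroup (Fin 2) ℂ)) (GaugeField.gaugeAct (fun x => (liftTransfTo F J K hJK (descTransf F J K hJK u) x)⁻¹) U₀)) ℓ)⁻¹) ^ 2)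
        ≤ wilsonAction4 (GaugeField.gaugeAct (fun x => (u x)⁻¹) U) -
          minActionRegPr F J K hJK ε₀ (GaugeField.gaugeAct (fun x => (descTransf F J K hJK u x)⁻¹) V))) :
    (μ * ((F.L : ℝ)⁻¹) ^ (2 * (K - J)) *
          (⨅ w : {w : GaugeTransf (F.P K) 0 (Matrix.specialUnitaryGroup (Fin 2) ℂ) | ∀ U : GaugeField (F.P K) 0 (Matrix.specialUnitaryGroup (Fin 2) ℂ),
              descendTo F ℰp J K hJK (GaugeField.gaugeAct w U) = descendTo F ℰp J K hJK U}, ∑ ℓ : PBond (F.P K) 0,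
            dist1 (U ℓ *
              ((GaugeField.gaugeAct (w : GaugeTransf (F.P K) 0 (Matrix.specialUnitaryGroup (Fin 2) ℂ)) U₀) ℓ)⁻¹) ^ 2)
        ≤ wilsonAction4 U -
          minActionRegPr F J K hJK ε₀ V) :=
  (body_iff_body_thm2Moved F hJK hε₀ u μ V U₀ U).mp h

/-! ## §2 Admissibility of the moved triple -/

/-- `u⁻¹•U` lies over the moved datum `(u↓)⁻¹•V` when `U` lies over `V`. [cite: Balaban1985Averaging, (11)-(13) p.19] -/
theorem thm2Moved_mem_fibre (u : Site (F.P K) 0 → Matrix.specialUnitaryGroup (Fin 2) ℂ) {U : GaugeField (F.P K) 0 (Matrix.specialUnitaryGroup (Fin 2) ℂ)}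
    {V : GaugeField (F.P J) 0 (Matrix.specialUnitaryGroup (Fin 2) ℂ)} (hU : U ∈ fibre F ℰp J K hJK V) :
    GaugeField.gaugeAct (fun x => (u x)⁻¹) U ∈ fibre F ℰp J K hJK (GaugeField.gaugeAct (fun x => (descTransf F J K hJK u x)⁻¹) V) := by
  have hV : descendTo F ℰp J K hJK U = V := hU
  show descendTo F ℰp J K hJK (GaugeField.gaugeAct (fun x => (u x)⁻¹) U) = _
  rw [descendTo_gaugeAct, descTransf_inv, hV]

/-- `ǔ⁻¹•U₀` minimises over the fibre of the moved datum (argmin set written out, as in GAP♯∘). [cite: Balaban1985Variational, Thm 1 p.279, (3)-(4) p.278] -/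
theorem thm2Moved_mem_argmin {θ : ℕ → ℝ} {ε₀ : ℝ} (hε₀ : 0 ≤ ε₀) (u : Site (F.P K) 0 → Matrix.specialUnitaryGroup (Fin 2) ℂ)
    (V : GaugeField (F.P J) 0 (Matrix.specialUnitaryGroup (Fin 2) ℂ)) {U₀ : GaugeField (F.P K) 0 (Matrix.specialUnitaryGroup (Fin 2) ℂ)}
    (hU₀ : U₀ ∈ {U' : GaugeField (F.P K) 0 (Matrix.specialUnitaryGroup (Fin 2) ℂ) | U' ∈ fibre F ℰp J K hJK V ∧ U' ∈ histGood F ℰp θ K J ∧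
      wilsonAction4 U' = minActionRegPr F J K hJK ε₀ V}) :
    GaugeField.gaugeAct (fun x => (liftTransfTo F J K hJK (descTransf F J K hJK u) x)⁻¹) U₀ ∈ {U' : GaugeField (F.P K) 0 (Matrix.specialUnitaryGroup (Fin 2) ℂ) |
      U' ∈ fibre F ℰp J K hJK (GaugeField.gaugeAct (fun x => (descTransf F J K hJK u x)⁻¹) V) ∧ U' ∈ histGood F ℰp θ K J ∧
      wilsonAction4 U' = minActionRegPr F J K hJK ε₀ (GaugeField.gaugeAct (fun x => (descTransf F J K hJK u x)⁻¹) V)} := by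
  have h := mem_argmin_gaugeAct_liftTransfTo F hJK hε₀ (fun x => (descTransf F J K hJK u x)⁻¹) V hU₀
  rwa [liftTransfTo_inv_fun] at h

/-! ## §3 The moved pair's relative chord -/

/-- ★ **THE RELATIVE CHORD OF THE MOVED PAIR IS `E·E′`**: if `u⁻¹•U = E·U₀` bondwise (Thm 2's representative), then against the moved background `ǔ⁻¹•U₀` the
relative bond variable is `E b · (U₀ b · ((ǔ⁻¹•U₀) b)⁻¹)` — `W·X` of (RES-u.5)'s `wordOsc_mlog_mul` with `W = E`, `X = E′ := U₀·(ǔ⁻¹•U₀)⁻¹` ((RES-u.4)'s object at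
`c = ǔ⁻¹`). [cite: Balaban1985RegularSpaces, Thm 2 p.83, (1.36)-(1.37) p.82] -/
theorem relChord_thm2Moved (u : Site (F.P K) 0 → Matrix.specialUnitaryGroup (Fin 2) ℂ) (E U₀ U : GaugeField (F.P K) 0 (Matrix.specialUnitaryGroup (Fin 2) ℂ))
    (hrep : GaugeField.gaugeAct (fun x => (u x)⁻¹) U = fun b => E b * U₀ b) (b : PBond (F.P K) 0) :
    (GaugeField.gaugeAct (fun x => (u x)⁻¹) U) b * ((GaugeField.gaugeAct (fun x => (liftTransfTo F J K hJK (descTransf F J K hJK u) x)⁻¹) U₀) b)⁻¹ =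
      E b * (U₀ b * ((GaugeField.gaugeAct (fun x => (liftTransfTo F J K hJK (descTransf F J K hJK u) x)⁻¹) U₀) b)⁻¹) := by
  rw [hrep, mul_assoc]

end Summit.QuantumFields.YangMills.Theorems.FluctuationComparisonRegPrIntLS2BetaBodyDoorThm2Moved

end
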